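import Literature.MathematicalPhysics.QuantumLattice.DWaveSourceTIClassWindowCertificate
import Literature.MathematicalPhysics.QuantumLattice.HubbardTTPrimeEnergyDensityVariationalPrinciple
import HarnessLib

/-!
# PINNING-FIELD rows: the TL-class NODE SHAPES of the sourced menus, as conclusions of the tree's reader

HONEST FRAMING: soundness glue; no certificate, no number, no order parameter, no phase word. A finite-`h` response
bound is a response, never an order parameter (cell hubbard-cq wording W1).

WHAT THIS FILE IS (cell hubbard-cq, D-0082 (c) / LADDER row PC-a, seat hubbard-cq-obsth-1 «pinning-field K5 menu
nodes with the pinning term»). The sourced (gbT, gauge-TWISTED `D₄ × flip`) menu certificates of hubbard-cq-pilot-1 and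
hubbard-cq-pilot-2 without ground-state rows — energy floors (jobs S/E/G/D) and pair-amplitude ceilings (M1–M5, L1–L3) —
are typed by hubbard-obs-pin-1 as CLAIM NODES in the translation-invariant-class vocabulary of
`Literature.…InfVolFermionState` (`Certificates/HubbardSquare_n7o8_pinning_menuA0p_responseCeilingM_nodes` etc.):
«`∀ σ`, `σ.IsTranslationInvariant → σ.density = n → [e^{src}_h(σ) ≤ u →] √2·Re σ(P₀^d) ≤ M̃`» /
«`… → ℓ ≤ e^{src}_h(σ)`». BOARD D-8 asks a claim node to be the EXACT conclusion shape of a tree soundness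
theorem applied to the certificate's identity. The reader is `Literature/…/DWaveSourceTIClassWindowCertificate`
(hubbard-cq-obsth-1 g4: the identity in `𝔄_{Λ'}` with flip-twisted defects, filling rows, a cap row on the sourced
energy and a floor row on the unsourced one; read in the orbit of the 32 flip-twisted transforms of a
translation-invariant state — «WLOG by averaging» as a theorem). This file spells its corollaries in EXACTLY the
node slots:

* `tiClass_meanEnergy_ge_of_energyDensityTT'_ge` — a certified TL floor `ℓ₀ ≤ e(1,t',U; n)` (`0 < n < 2`, `U ≥ 0`;
  e.g. mbsolver #473 / #505 at (8, 7/8, 0)) discharges the FLOOR ROW on the class: `ℓ₀ ≤ e^{tt'}(σ)` for every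
  translation-invariant `σ` of density `n` (`IsTranslationInvariant.energyDensityTT'_le_meanEnergy`).
* `tiClass_sourced_meanEnergy_ge_of_twistedFlip_certificate` — ENERGY-FLOOR NODES with per-spin filling rows at `n/2`
  and an optional unsourced-floor row (`κ⁻`, premise on the class; `κ⁻ = 0` for the unconditional `E*o` / `S` legs):
  `∀ σ, TI → σ.density = n → c − Σ‖aₖ‖ ≤ e^{src}_h(σ)`.
* `tiClass_sourced_meanEnergy_ge_of_twistedFlip_certificate_gc` — GRAND-CANONICAL energy floors (no filling rows, `μ`
  inside `e^{src}`; job-D `G_*`): `∀ σ, TI → c − Σ‖aₖ‖ ≤ e^{src}_{μ,h}(σ)`.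
* `tiClass_sqrt_two_mul_re_expect_localPairAt_le_of_twistedFlip_certificate` — RESPONSE-CEILING NODES (pair_amp MAX with
  filling rows, the cap row `κ⁺ (u·1 − Γ E^{src}_h)` and the optional floor row): `∀ σ, TI → σ.density = n →
  e^{src}_h(σ) ≤ u → √2·Re σ(P₀^d) ≤ M̃` whenever `−(c − Σ‖aₖ‖) ≤ √2·M̃` (the engine's `m̃ = Re ω(D₀)`, `D₀ = √2·P₀^d`).

Identity shape, reading recipe and units: HOME/hubbard-cq-obsth-1/CONSUMER-GRAMMAR-KKT.md §8–§9. Interface note: no local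
instance, no definition, no named fact, no `sorry`.

References: J. Wang et al., PRX 14 (2024) 031006 §III [WangEtAl2024]; T. Koma, H. Tasaki, J. Stat. Phys. 76 (1994) 745 §1
[KomaTasaki1994]; X. Han, arXiv:2006.06002 §3 [Han2020Bootstrap].
-/

noncomputable section

namespace Summit.Ventures.CertifiedManyBodySolver

open Literature.MathematicalPhysics.QuantumLattice Literature.MathematicalPhysics.QuantumLattice.ThermodynamicLimit
open Literature.MathematicalPhysics.QuantumManyBody.StateRelaxation
open Matrix HubbardWave0 Literature.Probability.LatticeModels Finset InfVolFermionState
open scoped BigOperators ComplexOrder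

/-! ## §1 Discharging the floor row from a certified thermodynamic-limit energy floor -/

/-- **A certified TL energy floor bounds the class**: if `ℓ₀ ≤ e(1, t', U; n)` (`energyDensityTT'`, the thermodynamic-limit
ground-state energy density at filling `n`, `0 < n < 2`, `U ≥ 0`), then `ℓ₀ ≤ e^{tt'}(σ)` for every translation-invariant state of
density `n` (Bratteli–Kishimoto–Robinson variational principle, tree `IsTranslationInvariant.energyDensityTT'_le_meanEnergy`).
The `(κ⁻, ℓ)` floor-row premise of the TL-class reader, in the shape its node corollaries take. [cite: WangEtAl2024, §III] -/
theorem tiClass_meanEnergy_ge_of_energyDensityTT'_ge {t' U n lo : ℝ} (hU : 0 ≤ U) (hn0 : 0 < n) (hn2 : n < 2)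
    (hlo : lo ≤ energyDensityTT' 1 t' U n) (κ : ℝ) (hκ : 0 ≤ κ) :
    ∀ σ : InfVolFermionState 2, σ.IsTranslationInvariant → σ.density = n →
      κ * lo ≤ κ * σ.meanEnergy (hubbardTTPrimeFermionInteraction 1 t' U) 1 := by
  intro σ hσ hρ
  refine mul_le_mul_of_nonneg_left (hlo.trans ?_) hκ
  have h := hσ.energyDensityTT'_le_meanEnergy 1 t' hU (hρ ▸ hn0) (hρ ▸ hn2)
  rwa [hρ] at h

/-! ## §2 Energy-floor nodes -/

/-- **ENERGY-FLOOR NODE SHAPE (canonical filling rows)**: a flip-twisted sourced window certificate (identity in `𝔄_{Λ'}`,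
CONSUMER-GRAMMAR §9) with objective `Γ E^{src}_h`, per-spin filling rows `μ_σ (n_{0σ} − (n/2)·1)`, and an unsourced floor
row `κ⁻ (Γ E^{tt'} − ℓ·1)` discharged on the class (`hlo`; take `κ⁻ = 0` when the certificate has none) proves
`∀ σ, σ.IsTranslationInvariant → σ.density = n → c − Σ‖aₖ‖ ≤ e^{src}_h(σ)` with
`e^{src}_h(σ) = σ.meanEnergy (hubbardTTPrimeSourcedInteraction 1 t' U μ dWaveFormFactor h) 1` — the sentence of the
`cert_pin1_E*` / `cert_pin2menuA0_*_E_*` nodes (there `μ = 0`, `n = 7/8`, `h = √2·g`). [cite: WangEtAl2024, §III] [cite: KomaTasaki1994, §1] -/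
theorem tiClass_sourced_meanEnergy_ge_of_twistedFlip_certificate (t' U μ h n : ℝ)
    {Λ Λ' : Finset (Site 2)} (hΛ : Λ ⊆ Λ') (h0 : thicken ({0} : Finset (Site 2)) 1 ⊆ Λ') (hz : (0 : Site 2) ∈ Λ')
    (κm lo : ℝ) (μc : Fin 2 → ℝ)
    (hlo : ∀ σ : InfVolFermionState 2, σ.IsTranslationInvariant → σ.density = n →
      κm * lo ≤ κm * σ.meanEnergy (hubbardTTPrimeFermionInteraction 1 t' U) 1)
    {m : Type*} [Fintype m] [DecidableEq m] {Λm : Matrix m m ℂ} (hΛm : Λm.PosSemidef) (O : m → FermionOp Λ')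
    {ι : Type*} (tt : Finset ι) (γ : ι → DihedralGroup 4) (wv : ι → Site 2) (fl mt : ι → Fin 2)
    (hsh : ∀ l, d4ShiftSet (γ l) (wv l) Λ ⊆ Λ') (bb : ι → ℂ) (yw : ι → List (Orb (PolySite Λ) × Bool))
    {δ : Type*} (ah : Finset δ) (dc : δ → ℝ) (V : δ → FermionOp Λ')
    {κ'' : Type*} (w : Finset κ'') (a : κ'' → ℂ) (word : κ'' → List (Orb (PolySite Λ') × Bool)) {c : ℝ}
    (hcert : fermionEmbed (PolySite.incl h0) ((hubbardTTPrimeSourcedInteraction 1 t' U μ dWaveFormFactor h).meanEnergyObs 1) -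
        (c : ℂ) • (1 : FermionOp Λ') -
        ∑ σ : Fin 2, ((μc σ : ℝ) : ℂ) • (nAt 0 hz σ - (((n / 2 : ℝ) : ℝ) : ℂ) • (1 : FermionOp Λ')) -
        ((κm : ℝ) : ℂ) • (fermionEmbed (PolySite.incl h0) ((hubbardTTPrimeFermionInteraction 1 t' U).meanEnergyObs 1) -
          ((lo : ℝ) : ℂ) • (1 : FermionOp Λ')) =
      gramForm Λm O +
        ∑ l ∈ tt, bb l • (gaugePhase (twistFlipExp (γ l) (fl l) (mt l)) (yw l) •
            fermionEmbed (PolySite.incl (hsh l))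
              (fermionEmbed (PolySite.d4Emb (γ l) (wv l) Λ) (spinSwapIter (fl l).val (ladderWord (yw l)))) -
          fermionEmbed (PolySite.incl hΛ) (ladderWord (yw l))) +
        (∑ m' ∈ ah, ((dc m' : ℝ) : ℂ) • ((V m')ᴴ - V m') + ∑ k ∈ w, a k • ladderWord (word k))) :
    ∀ σ : InfVolFermionState 2, σ.IsTranslationInvariant → σ.density = n →
      c - ∑ k ∈ w, ‖a k‖ ≤ σ.meanEnergy (hubbardTTPrimeSourcedInteraction 1 t' U μ dWaveFormFactor h) 1 := by
  intro σ hσ hρ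
  set R := gramForm Λm O +
        ∑ l ∈ tt, bb l • (gaugePhase (twistFlipExp (γ l) (fl l) (mt l)) (yw l) •
            fermionEmbed (PolySite.incl (hsh l))
              (fermionEmbed (PolySite.d4Emb (γ l) (wv l) Λ) (spinSwapIter (fl l).val (ladderWord (yw l)))) -
          fermionEmbed (PolySite.incl hΛ) (ladderWord (yw l))) +
        (∑ m' ∈ ah, ((dc m' : ℝ) : ℂ) • ((V m')ᴴ - V m') + ∑ k ∈ w, a k • ladderWord (word k)) with hR
  have hcert' : fermionEmbed (PolySite.incl h0) ((hubbardTTPrimeSourcedInteraction 1 t' U μ dWaveFormFactor h).meanEnergyObs 1) -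
        (c : ℂ) • (1 : FermionOp Λ') -
        ∑ σ : Fin 2, ((μc σ : ℝ) : ℂ) • (nAt 0 hz σ - (((n / 2 : ℝ) : ℝ) : ℂ) • (1 : FermionOp Λ')) -
        (((0 : ℝ) : ℝ) : ℂ) • ((((0 : ℝ) : ℝ) : ℂ) • (1 : FermionOp Λ') -
          fermionEmbed (PolySite.incl h0) ((hubbardTTPrimeSourcedInteraction 1 t' U μ dWaveFormFactor h).meanEnergyObs 1)) -
        ((κm : ℝ) : ℂ) • (fermionEmbed (PolySite.incl h0) ((hubbardTTPrimeFermionInteraction 1 t' U).meanEnergyObs 1) -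
          ((lo : ℝ) : ℂ) • (1 : FermionOp Λ')) = R := by
    rw [Complex.ofReal_zero, zero_smul, sub_zero]; exact hcert
  have hmain := hσ.le_meanEnergy_sourced_of_twistedFlip_certificate t' U μ h hΛ h0 hz 0 κm 0 lo μc (n / 2) (by simp)
    (fun σ' hσ' hρ' => hlo σ' hσ' (hρ'.trans hρ)) hΛm O tt γ wv fl mt hsh bb yw ah dc V w a word hcert'
  rw [hρ, sub_self, mul_zero, add_zero] at hmain
  exact hmain

/-- **GRAND-CANONICAL ENERGY-FLOOR NODE SHAPE (no filling rows)**: the same identity WITHOUT filling rows and WITHOUT the floor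
row (the chemical potential sits inside `e^{src}_{μ,h}`; job-D `G_*` legs, `h = 0`, `μ = 3/2, 7/4, 2`) proves
`∀ σ, σ.IsTranslationInvariant → c − Σ‖aₖ‖ ≤ e^{src}_{μ,h}(σ)` — every translation-invariant state, any density: the sentence
behind the `cert_pin1_jobD_G_*` nodes' certificates (these nodes are typed in the weaker torus-row shape
`∃ L₀, SourcedEnergyLowerRow 0 8 μ 0 1 L₀ ℓ`; the TL-class sentence is the certificate's own claim text).
[cite: WangEtAl2024, §III] [cite: KomaTasaki1994, §1] -/
theorem tiClass_sourced_meanEnergy_ge_of_twistedFlip_certificate_gc (t' U μ h : ℝ)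
    {Λ Λ' : Finset (Site 2)} (hΛ : Λ ⊆ Λ') (h0 : thicken ({0} : Finset (Site 2)) 1 ⊆ Λ') (hz : (0 : Site 2) ∈ Λ')
    {m : Type*} [Fintype m] [DecidableEq m] {Λm : Matrix m m ℂ} (hΛm : Λm.PosSemidef) (O : m → FermionOp Λ')
    {ι : Type*} (tt : Finset ι) (γ : ι → DihedralGroup 4) (wv : ι → Site 2) (fl mt : ι → Fin 2)
    (hsh : ∀ l, d4ShiftSet (γ l) (wv l) Λ ⊆ Λ') (bb : ι → ℂ) (yw : ι → List (Orb (PolySite Λ) × Bool))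
    {δ : Type*} (ah : Finset δ) (dc : δ → ℝ) (V : δ → FermionOp Λ')
    {κ'' : Type*} (w : Finset κ'') (a : κ'' → ℂ) (word : κ'' → List (Orb (PolySite Λ') × Bool)) {c : ℝ}
    (hcert : fermionEmbed (PolySite.incl h0) ((hubbardTTPrimeSourcedInteraction 1 t' U μ dWaveFormFactor h).meanEnergyObs 1) -
        (c : ℂ) • (1 : FermionOp Λ') =
      gramForm Λm O +
        ∑ l ∈ tt, bb l • (gaugePhase (twistFlipExp (γ l) (fl l) (mt l)) (yw l) •
            fermionEmbed (PolySite.incl (hsh l))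
              (fermionEmbed (PolySite.d4Emb (γ l) (wv l) Λ) (spinSwapIter (fl l).val (ladderWord (yw l)))) -
          fermionEmbed (PolySite.incl hΛ) (ladderWord (yw l))) +
        (∑ m' ∈ ah, ((dc m' : ℝ) : ℂ) • ((V m')ᴴ - V m') + ∑ k ∈ w, a k • ladderWord (word k))) :
    ∀ σ : InfVolFermionState 2, σ.IsTranslationInvariant →
      c - ∑ k ∈ w, ‖a k‖ ≤ σ.meanEnergy (hubbardTTPrimeSourcedInteraction 1 t' U μ dWaveFormFactor h) 1 := by
  intro σ hσ
  set R := gramForm Λm O +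
        ∑ l ∈ tt, bb l • (gaugePhase (twistFlipExp (γ l) (fl l) (mt l)) (yw l) •
            fermionEmbed (PolySite.incl (hsh l))
              (fermionEmbed (PolySite.d4Emb (γ l) (wv l) Λ) (spinSwapIter (fl l).val (ladderWord (yw l)))) -
          fermionEmbed (PolySite.incl hΛ) (ladderWord (yw l))) +
        (∑ m' ∈ ah, ((dc m' : ℝ) : ℂ) • ((V m')ᴴ - V m') + ∑ k ∈ w, a k • ladderWord (word k)) with hR
  have hcert' : fermionEmbed (PolySite.incl h0) ((hubbardTTPrimeSourcedInteraction 1 t' U μ dWaveFormFactor h).meanEnergyObs 1) -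
        (c : ℂ) • (1 : FermionOp Λ') -
        ∑ σ : Fin 2, (((fun _ => (0 : ℝ)) σ : ℝ) : ℂ) • (nAt 0 hz σ - (((0 : ℝ) : ℝ) : ℂ) • (1 : FermionOp Λ')) -
        (((0 : ℝ) : ℝ) : ℂ) • ((((0 : ℝ) : ℝ) : ℂ) • (1 : FermionOp Λ') -
          fermionEmbed (PolySite.incl h0) ((hubbardTTPrimeSourcedInteraction 1 t' U μ dWaveFormFactor h).meanEnergyObs 1)) -
        (((0 : ℝ) : ℝ) : ℂ) • (fermionEmbed (PolySite.incl h0) ((hubbardTTPrimeFermionInteraction 1 t' U).meanEnergyObs 1) -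
          (((0 : ℝ) : ℝ) : ℂ) • (1 : FermionOp Λ')) = R := by
    simp only [Complex.ofReal_zero, zero_smul, sub_zero, Finset.sum_const_zero]; exact hcert
  have hmain := hσ.le_meanEnergy_sourced_of_twistedFlip_certificate t' U μ h hΛ h0 hz 0 0 0 0 (fun _ => 0) 0 (by simp)
    (fun σ' _ _ => by simp) hΛm O tt γ wv fl mt hsh bb yw ah dc V w a word hcert'
  simp only [Finset.sum_const_zero, zero_mul, add_zero] at hmain
  exact hmain

/-! ## §3 Response-ceiling nodes -/

/-- `2x ≤ r` and `r ≤ √2·M` give `√2·x ≤ M`. [cite: KomaTasaki1994, §1] -/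
theorem sqrt_two_mul_le_of_two_mul_le {x r M : ℝ} (hx : 2 * x ≤ r) (hM : r ≤ Real.sqrt 2 * M) : Real.sqrt 2 * x ≤ M := by
  have hs : Real.sqrt 2 * Real.sqrt 2 = 2 := Real.mul_self_sqrt (by norm_num)
  have hpos : 0 ≤ Real.sqrt 2 / 2 := div_nonneg (Real.sqrt_nonneg 2) (by norm_num)
  calc Real.sqrt 2 * x = Real.sqrt 2 / 2 * (2 * x) := by ring
    _ ≤ Real.sqrt 2 / 2 * r := mul_le_mul_of_nonneg_left hx hpos
    _ ≤ Real.sqrt 2 / 2 * (Real.sqrt 2 * M) := mul_le_mul_of_nonneg_left hM hpos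
    _ = Real.sqrt 2 * Real.sqrt 2 / 2 * M := by ring
    _ = M := by rw [hs]; ring

/-- **RESPONSE-CEILING NODE SHAPE**: a flip-twisted sourced window certificate with the pair objective in the MAX program
(`Xw = −(Γ P₀^d + (Γ P₀^d)ᴴ)`), per-spin filling rows at `n/2`, the cap row `κ⁺ (u·1 − Γ E^{src}_h)` and the optional floor row
`κ⁻ (Γ E^{tt'} − ℓ·1)` (premise on the class; `κ⁻ = 0` when absent), and a slot `M̃` with `−(c − Σ‖aₖ‖) ≤ √2·M̃`, proves
`∀ σ, σ.IsTranslationInvariant → σ.density = n → e^{src}_h(σ) ≤ u → √2·Re σ(P₀^d) ≤ M̃`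
(`P₀^d = localPairAt ({0} ∪ unitSteps) dWaveFormFactor 0`; `κ⁺ ≥ 0`) — the sentence of the `cert_pin1_M*` /
`cert_pin2menuA0_*_L*` nodes (`μ = 0`, `n = 7/8`, `u` = the transported cap #354 / #445). A finite-`h` RESPONSE CEILING; it never
speaks to presence or absence of order. [cite: KomaTasaki1994, §1] [cite: WangEtAl2024, §III] -/
theorem tiClass_sqrt_two_mul_re_expect_localPairAt_le_of_twistedFlip_certificate (t' U μ h n : ℝ)
    {Λ Λ' : Finset (Site 2)} (hΛ : Λ ⊆ Λ') (h0 : thicken ({0} : Finset (Site 2)) 1 ⊆ Λ') (hz : (0 : Site 2) ∈ Λ')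
    (hP : pairRegion (insert (0 : Site 2) unitSteps) 0 ⊆ Λ')
    {κp : ℝ} (hκp : 0 ≤ κp) (κm u lo : ℝ) (μc : Fin 2 → ℝ) {M : ℝ}
    (hlo : ∀ σ : InfVolFermionState 2, σ.IsTranslationInvariant → σ.density = n →
      κm * lo ≤ κm * σ.meanEnergy (hubbardTTPrimeFermionInteraction 1 t' U) 1)
    {m : Type*} [Fintype m] [DecidableEq m] {Λm : Matrix m m ℂ} (hΛm : Λm.PosSemidef) (O : m → FermionOp Λ')
    {ι : Type*} (tt : Finset ι) (γ : ι → DihedralGroup 4) (wv : ι → Site 2) (fl mt : ι → Fin 2)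
    (hsh : ∀ l, d4ShiftSet (γ l) (wv l) Λ ⊆ Λ') (bb : ι → ℂ) (yw : ι → List (Orb (PolySite Λ) × Bool))
    {δ : Type*} (ah : Finset δ) (dc : δ → ℝ) (V : δ → FermionOp Λ')
    {κ'' : Type*} (w : Finset κ'') (a : κ'' → ℂ) (word : κ'' → List (Orb (PolySite Λ') × Bool)) {c : ℝ}
    (hM : -(c - ∑ k ∈ w, ‖a k‖) ≤ Real.sqrt 2 * M)
    (hcert : -(fermionEmbed (PolySite.incl hP) (localPairAt (insert (0 : Site 2) unitSteps) dWaveFormFactor 0) +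
          (fermionEmbed (PolySite.incl hP) (localPairAt (insert (0 : Site 2) unitSteps) dWaveFormFactor 0))ᴴ) -
        (c : ℂ) • (1 : FermionOp Λ') -
        ∑ σ : Fin 2, ((μc σ : ℝ) : ℂ) • (nAt 0 hz σ - (((n / 2 : ℝ) : ℝ) : ℂ) • (1 : FermionOp Λ')) -
        ((κp : ℝ) : ℂ) • (((u : ℝ) : ℂ) • (1 : FermionOp Λ') -
          fermionEmbed (PolySite.incl h0) ((hubbardTTPrimeSourcedInteraction 1 t' U μ dWaveFormFactor h).meanEnergyObs 1)) -
        ((κm : ℝ) : ℂ) • (fermionEmbed (PolySite.incl h0) ((hubbardTTPrimeFermionInteraction 1 t' U).meanEnergyObs 1) -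
          ((lo : ℝ) : ℂ) • (1 : FermionOp Λ')) =
      gramForm Λm O +
        ∑ l ∈ tt, bb l • (gaugePhase (twistFlipExp (γ l) (fl l) (mt l)) (yw l) •
            fermionEmbed (PolySite.incl (hsh l))
              (fermionEmbed (PolySite.d4Emb (γ l) (wv l) Λ) (spinSwapIter (fl l).val (ladderWord (yw l)))) -
          fermionEmbed (PolySite.incl hΛ) (ladderWord (yw l))) +
        (∑ m' ∈ ah, ((dc m' : ℝ) : ℂ) • ((V m')ᴴ - V m') + ∑ k ∈ w, a k • ladderWord (word k))) :
    ∀ σ : InfVolFermionState 2, σ.IsTranslationInvariant → σ.density = n →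
      σ.meanEnergy (hubbardTTPrimeSourcedInteraction 1 t' U μ dWaveFormFactor h) 1 ≤ u →
        Real.sqrt 2 * (σ.expect (pairRegion (insert (0 : Site 2) unitSteps) 0)
          (localPairAt (insert (0 : Site 2) unitSteps) dWaveFormFactor 0)).re ≤ M := by
  intro σ hσ hρ hcap
  have hmain := hσ.two_mul_re_expect_localPairAt_le_of_twistedFlip_certificate t' U μ h hΛ h0 hz hP κp κm u lo μc (n / 2)
    (mul_le_mul_of_nonneg_left hcap hκp) (fun σ' hσ' hρ' => hlo σ' hσ' (hρ'.trans hρ)) hΛm O tt γ wv fl mt hsh bb yw ah dc V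
    w a word hcert
  rw [hρ, sub_self, mul_zero, add_zero] at hmain
  exact sqrt_two_mul_le_of_two_mul_le hmain hM

end Summit.Ventures.CertifiedManyBodySolver

end
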